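import Summits.PneNP.PneNP.Theorems.PositionalGamesParityMonotoneQuasipolyUpperComplete
import Literature.Computability.Complexity.NegationLimitedProofs
import Literature.Computability.Complexity.CircuitLowerBoundsProofs
import Literature.Computability.Complexity.PseudoComplementCircuits
import Literature.Barriers.PneNP.NegationLimitedGapProofs

/-!
# Progress-measure lifting: the monotone straight-line program
(route PneNP/PositionalGames, support item stmt-PneNP-1298 `ParityMonotoneQuasipolyUpper`)

* The bit invariant (`iterate_roundFn_inr`): on a dead-end-free input, after `k` rounds of
  `roundFn` the wire `(u, t)` carries `[iter k u < t]`; input wires are copied.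
* `outFn_iterate_eq_winFn`: the output `NoEvenDeadEnd ∧ (SomeOddDeadEnd ∨ [μ v < ⊤])` after
  `|V|·|Val U|` rounds IS `ParityGame.winFn o p v` on every input (dead ends included).
* Realisation in the `CktSize` calculus over `monotoneBasis01 = {∧₂, ∨₂, 0, 1}` (constants from
  `cktSize_const_mono01` / `cktSize_consts_mono01`): the initial wires (2 constant gates), one round (`|V × Val U| · 2|V|` gates: an `n`-ary OR of ANDs resp. AND of ORs
  per wire), the output stage, the whole program (`cktSize_winFn`), and the passage to
  `circuitSizeOver monotoneBasis` by constant elimination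
  (`GateList.const_or_exists_monotone_circuit`; a constant function has no `{∧₂, ∨₂}`-circuit and
  complexity `0`): `circuitSizeOver_le_of_cktSize01`.
-/

namespace Summit.PneNP.PneNP.Theorems.ParityLifting

set_option linter.dupNamespace false -- `Summit.PneNP.PneNP.…`: summit = sub-problem (D-0017)

open Literature.Combinatorics.Games

variable {U : Finset (List ℕ)} {V : Type*} [Fintype V]

/-! ## The threshold bits: the round map computes lifting -/

section Bits

variable (o : V → Bool) (p : V → ℕ) (H : ℕ)

/-- The input wires are copied through every round. -/
theorem iterate_roundFn_inl (x : V × V → Bool) (k : ℕ) (e : V × V) :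
    ((roundFn (U := U) o p H)^[k] (initFn x)) (.inl e) = x e := by
  induction k with
  | zero => rfl
  | succ k ih =>
    rw [Function.iterate_succ_apply']
    exact ih

/-- **The bit invariant.** On a dead-end-free input, after `k` rounds the wire `(u, t)` carries
`[iter k u < t]`. -/
theorem iterate_roundFn_inr {x : V × V → Bool} (hx : ∀ u, ∃ w, x (u, w) = o u) (k : ℕ) (u : V)
    (t : Val U) :
    ((roundFn o p H)^[k] (initFn x)) (.inr (u, t)) = decide (iter o p H x k u < t) := by
  classical
  induction k generalizing u t with
  | zero => rfl
  | succ k ih =>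
    rw [Function.iterate_succ_apply', iter_succ]
    have hround : ∀ y : Wire V U → Bool, roundFn o p H y (.inr (u, t)) =
        if o u = true then
          decide (∃ w, y (.inl (u, w)) = true ∧
            y (.inr (w, theta (tl H (p u)) (decide (Odd (p u))) t)) = true)
        else
          decide (∀ w, y (.inl (u, w)) = true ∨
            y (.inr (w, theta (tl H (p u)) (decide (Odd (p u))) t)) = true) := fun y => rfl
    rw [hround]
    have hθ : ∀ m : Val U, m < theta (tl H (p u)) (decide (Odd (p u))) t ↔
        lift (tl H (p u)) (decide (Odd (p u))) m < t := fun m => lt_theta_iff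
    simp only [iterate_roundFn_inl, ih, decide_eq_true_eq, hθ]
    unfold step
    split_ifs with ho
    · apply decide_eq_decide.2
      rw [Finset.inf_lt_iff]
      simp
    · apply decide_eq_decide.2
      rw [Bool.not_eq_true] at ho
      rcases eq_or_ne t ⊥ with rfl | ht
      · simp only [not_lt_bot, or_false, iff_false, not_forall]
        obtain ⟨w, hw⟩ := hx u
        exact ⟨w, by rw [hw, ho]; decide⟩
      · rw [Finset.sup_lt_iff (bot_lt_iff_ne_bot.2 ht)]
        simp only [Finset.mem_filter, Finset.mem_univ, true_and]
        constructor
        · intro h w hw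
          rcases h w with h1 | h1
          · rw [hw] at h1
            exact absurd h1 (by decide)
          · exact h1
        · intro h w
          cases hxw : x (u, w)
          · exact Or.inr (h w hxw)
          · exact Or.inl rfl

/-- **The output wire is WIN.** For `|V| ≤ 2^kk - 1`, priorities with `p u + 2 ≤ 2H` and `U`
containing the depth-`H` level of `OrderedTree.univ kk H`, the output of the lifting program after
`|V| · |Val U|` rounds is `ParityGame.winFn o p v` — on every input, dead ends included. -/
theorem outFn_iterate_eq_winFn (hp : ∀ u, p u + 2 ≤ 2 * H) {kk : ℕ}
    (hU : ∀ l ∈ (OrderedTree.univ kk H).nodes, l.length = H → l ∈ U)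
    (hV : Fintype.card V ≤ 2 ^ kk - 1) (v : V) (x : V × V → Bool) :
    outFn o v ((roundFn (U := U) o p H)^[Fintype.card V * Fintype.card (Val U)] (initFn x)) =
      ParityGame.winFn o p v x := by
  classical
  unfold outFn ParityGame.winFn
  simp only [iterate_roundFn_inl]
  apply decide_eq_decide.2
  by_cases hNED : ∀ u, o u = true → ∃ w, x (u, w) = true
  · by_cases hSOD : ∃ u, o u = false ∧ ∀ w, x (u, w) = true
    · -- some Odd vertex is stuck: Even wins vacuously
      refine iff_of_true ⟨hNED, Or.inl hSOD⟩ ?_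
      choose! σ hσ using hNED
      obtain ⟨u₀, hu₀, hstuck⟩ := hSOD
      refine ⟨σ, fun u hu => ?_, fun τ hτ => ?_⟩
      · show x (u, σ u) = o u
        rw [hσ u hu, hu]
      · exfalso
        have h := hτ u₀ hu₀
        simp only [ParityGame.edgeOfBits, hu₀, hstuck] at h
        exact absurd h (by decide)
    · -- no dead ends: the lifting fixpoint decides
      have hx : ∀ u, ∃ w, x (u, w) = o u := by
        intro u
        cases ho : o u
        · by_contra hno
          push Not at hno
          exact hSOD ⟨u, ho, fun w => by
            have := hno w
            simpa using this⟩
        · exact hNED u ho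
      simp only [iterate_roundFn_inr o p H hx, decide_eq_true_eq]
      rw [iter_lt_top_iff hx hp hU hV]
      constructor
      · rintro ⟨-, h | h⟩
        · exact absurd h hSOD
        · exact h
      · exact fun h => ⟨hNED, Or.inr h⟩
  · -- some Even vertex is stuck: Even cannot even move legally
    refine iff_of_false (fun h => hNED h.1) ?_
    rintro ⟨σ, hσ, -⟩
    apply hNED
    intro u hu
    exact ⟨σ u, by have h := hσ u hu; simpa [ParityGame.edgeOfBits, hu] using h⟩

end Bits

/-! ## The monotone straight-line program -/

section Circuit

open Literature.Computability.Complexity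

/-- `∃` over a nonempty finite index type: a chain of ORs. -/
theorem cktSize_exists (κ : Type*) [Fintype κ] [Nonempty κ] :
    CktSize monotoneBasis01 (fun (z : κ → Bool) (_ : Unit) => decide (∃ k, z k = true))
      (Fintype.card κ) := by
  classical
  have hne : (Finset.univ : Finset κ).toList ≠ [] := by
    rw [Ne, Finset.toList_eq_nil, Finset.univ_eq_empty_iff]
    exact not_isEmpty_of_nonempty κ
  have h := (cktSize_any (Finset.univ : Finset κ).toList hne).basis_mono
    monotoneBasis_subset_monotoneBasis01
  rw [Finset.length_toList, Finset.card_univ] at h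
  refine h.congr fun z _ => ?_
  apply Bool.eq_iff_iff.2
  rw [List.any_eq_true, decide_eq_true_iff]
  simp [Finset.mem_toList]

/-- `∀` over a nonempty finite index type: a chain of ANDs. -/
theorem cktSize_forall (κ : Type*) [Fintype κ] [Nonempty κ] :
    CktSize monotoneBasis01 (fun (z : κ → Bool) (_ : Unit) => decide (∀ k, z k = true))
      (Fintype.card κ) := by
  classical
  have hne : (Finset.univ : Finset κ).toList ≠ [] := by
    rw [Ne, Finset.toList_eq_nil, Finset.univ_eq_empty_iff]
    exact not_isEmpty_of_nonempty κ
  have h := (cktSize_all (Finset.univ : Finset κ).toList hne).basis_mono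
    monotoneBasis_subset_monotoneBasis01
  rw [Finset.length_toList, Finset.card_univ] at h
  refine h.congr fun z _ => ?_
  apply Bool.eq_iff_iff.2
  rw [List.all_eq_true, decide_eq_true_iff]
  simp [Finset.mem_toList]

variable [Nonempty V]

/-- The Even gadget `⋁_w y(u,w) ∧ y(w, θ w)`: `2|V|` gates. -/
theorem cktSize_gadget_even (u : V) (θ : V → Val U) :
    CktSize monotoneBasis01 (fun (y : Wire V U → Bool) (_ : Unit) =>
      decide (∃ w, y (.inl (u, w)) = true ∧ y (.inr (w, θ w)) = true))
      (Fintype.card V + Fintype.card V) := by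
  have h1 : CktSize monotoneBasis01
      (fun (y : Wire V U → Bool) (w : V) => y (.inl (u, w)) && y (.inr (w, θ w)))
      (Fintype.card V * 1) :=
    CktSize.pi_const fun w =>
      (cktSize_and_mono (Sum.inl (u, w)) (Sum.inr (w, θ w))).basis_mono
        monotoneBasis_subset_monotoneBasis01
  have h2 := h1.comp (cktSize_exists V)
  rw [mul_one] at h2
  refine h2.congr fun y _ => ?_
  simp only [Bool.and_eq_true]

/-- The Odd gadget `⋀_w y(u,w) ∨ y(w, θ w)`: `2|V|` gates. -/
theorem cktSize_gadget_odd (u : V) (θ : V → Val U) :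
    CktSize monotoneBasis01 (fun (y : Wire V U → Bool) (_ : Unit) =>
      decide (∀ w, y (.inl (u, w)) = true ∨ y (.inr (w, θ w)) = true))
      (Fintype.card V + Fintype.card V) := by
  have h1 : CktSize monotoneBasis01
      (fun (y : Wire V U → Bool) (w : V) => y (.inl (u, w)) || y (.inr (w, θ w)))
      (Fintype.card V * 1) :=
    CktSize.pi_const fun w =>
      (cktSize_or_mono (Sum.inl (u, w)) (Sum.inr (w, θ w))).basis_mono
        monotoneBasis_subset_monotoneBasis01
  have h2 := h1.comp (cktSize_forall V)
  rw [mul_one] at h2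
  refine h2.congr fun y _ => ?_
  simp only [Bool.or_eq_true]

variable (o : V → Bool) (p : V → ℕ) (H : ℕ)

/-- **One round of lifting is a monotone program with `|V × Val U| · 2|V|` gates.** -/
theorem cktSize_roundFn :
    CktSize monotoneBasis01 (roundFn (U := U) o p H)
      (Fintype.card (V × Val U) * (Fintype.card V + Fintype.card V)) := by
  classical
  have hG : CktSize monotoneBasis01
      (fun (y : Wire V U → Bool) (ut : V × Val U) => roundFn o p H y (.inr ut))
      (Fintype.card (V × Val U) * (Fintype.card V + Fintype.card V)) := by
    apply CktSize.pi_const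
    rintro ⟨u, t⟩
    by_cases ho : o u = true
    · refine (cktSize_gadget_even u fun _ => theta (tl H (p u)) (decide (Odd (p u))) t).congr
        fun y _ => ?_
      simp [roundFn, ho]
    · refine (cktSize_gadget_odd u fun _ => theta (tl H (p u)) (decide (Odd (p u))) t).congr
        fun y _ => ?_
      simp [roundFn, ho]
  have h := (CktSize.proj monotoneBasis01 (fun e : V × V => (Sum.inl e : Wire V U))).pair hG
  rw [zero_add] at h
  refine h.congr fun y w => ?_
  rcases w with e | ut <;> rfl

omit [Fintype V] [Nonempty V] in
/-- **The initial wires cost two (constant) gates.** -/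
theorem cktSize_initFn : CktSize monotoneBasis01 (fun x => initFn (U := U) (V := V) x) 2 := by
  have hc : CktSize monotoneBasis01
      (fun (_ : V × V → Bool) (ut : V × Val U) => decide (⊥ < ut.2)) 2 := by
    exact ((cktSize_consts_mono01 (V × V)).outMap fun ut : V × Val U => decide (⊥ < ut.2)).congr
      fun _ _ => rfl
  have h := (CktSize.id monotoneBasis01).pair hc
  refine h.congr fun x w => ?_
  rcases w with e | ⟨u, t⟩ <;> rfl

/-- `NoEvenDeadEnd` as a monotone program. -/
theorem cktSize_noEvenDeadEnd :
    CktSize monotoneBasis01 (fun (y : Wire V U → Bool) (_ : Unit) =>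
      decide (∀ u, o u = true → ∃ w, y (.inl (u, w)) = true))
      (Fintype.card V * Fintype.card V + Fintype.card V) := by
  classical
  by_cases hE : Nonempty {u // o u = true}
  · have h1 : CktSize monotoneBasis01
        (fun (y : Wire V U → Bool) (u : {u // o u = true}) => decide (∃ w, y (.inl (u.1, w)) = true))
        (Fintype.card {u // o u = true} * Fintype.card V) :=
      CktSize.pi_const fun u => (cktSize_exists V).rewire fun w => (Sum.inl (u.1, w) : Wire V U)
    have h2 := h1.comp (cktSize_forall {u // o u = true})
    refine (h2.of_le ?_).congr fun y _ => ?_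
    · have := Fintype.card_subtype_le (fun u => o u = true)
      nlinarith
    · apply decide_eq_decide.2
      simp only [decide_eq_true_eq, Subtype.forall]
  · have hc := Fintype.card_pos (α := V)
    refine ((cktSize_const_mono01 (Wire V U) true).of_le (by nlinarith)).congr fun y _ => ?_
    symm
    apply decide_eq_true
    intro u hu
    exact absurd ⟨⟨u, hu⟩⟩ hE

/-- `SomeOddDeadEnd` as a monotone program. -/
theorem cktSize_someOddDeadEnd :
    CktSize monotoneBasis01 (fun (y : Wire V U → Bool) (_ : Unit) =>
      decide (∃ u, o u = false ∧ ∀ w, y (.inl (u, w)) = true))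
      (Fintype.card V * Fintype.card V + Fintype.card V) := by
  classical
  by_cases hO : Nonempty {u // o u = false}
  · have h1 : CktSize monotoneBasis01
        (fun (y : Wire V U → Bool) (u : {u // o u = false}) => decide (∀ w, y (.inl (u.1, w)) = true))
        (Fintype.card {u // o u = false} * Fintype.card V) :=
      CktSize.pi_const fun u => (cktSize_forall V).rewire fun w => (Sum.inl (u.1, w) : Wire V U)
    have h2 := h1.comp (cktSize_exists {u // o u = false})
    refine (h2.of_le ?_).congr fun y _ => ?_
    · have := Fintype.card_subtype_le (fun u => o u = false)
      nlinarith
    · apply decide_eq_decide.2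
      simp only [decide_eq_true_eq, Subtype.exists, exists_prop]
  · have hc := Fintype.card_pos (α := V)
    refine ((cktSize_const_mono01 (Wire V U) false).of_le (by nlinarith)).congr fun y _ => ?_
    symm
    apply decide_eq_false
    rintro ⟨u, hu, -⟩
    exact hO ⟨⟨u, hu⟩⟩

/-- `a ∧ (b ∨ c)` on three wires: two gates. -/
theorem cktSize_and_or {ι : Type*} (i j k : ι) :
    CktSize monotoneBasis01 (fun (z : ι → Bool) (_ : Unit) => z i && (z j || z k)) 2 := by
  have h1 := (CktSize.id monotoneBasis01).pair
    ((cktSize_or_mono j k).basis_mono monotoneBasis_subset_monotoneBasis01)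
  have h2 := h1.comp ((cktSize_and_mono (Sum.inl i) (Sum.inr ())).basis_mono
    monotoneBasis_subset_monotoneBasis01)
  exact h2.congr fun z _ => rfl

/-- **The output stage**: `NoEvenDeadEnd ∧ (SomeOddDeadEnd ∨ [μ v < ⊤])`. -/
theorem cktSize_outFn (v : V) :
    CktSize monotoneBasis01 (fun (y : Wire V U → Bool) (_ : Unit) => outFn o v y)
      (2 * (Fintype.card V * Fintype.card V + Fintype.card V) + 2) := by
  have h1 := (cktSize_noEvenDeadEnd (U := U) o).pair ((cktSize_someOddDeadEnd (U := U) o).pair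
    (CktSize.proj monotoneBasis01 fun _ : Unit => (Sum.inr (v, ⊤) : Wire V U)))
  have h2 := h1.comp (cktSize_and_or (Sum.inl ()) (Sum.inr (Sum.inl ())) (Sum.inr (Sum.inr ())))
  refine (h2.of_le (by omega)).congr fun y _ => ?_
  simp only [outFn, Sum.elim_inl, Sum.elim_inr, Bool.decide_and, Bool.decide_or, Bool.decide_eq_true]

/-- **The whole lifting program**: initial wires, `K` rounds, output stage. -/
theorem cktSize_pipeline (v : V) (K : ℕ) :
    CktSize monotoneBasis01
      (fun x (_ : Unit) => outFn o v ((roundFn (U := U) o p H)^[K] (initFn x)))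
      (2 + K * (Fintype.card (V × Val U) * (Fintype.card V + Fintype.card V)) +
        (2 * (Fintype.card V * Fintype.card V + Fintype.card V) + 2)) :=
  ((cktSize_initFn.comp ((cktSize_roundFn o p H).iterate K)).comp (cktSize_outFn o v)).congr
    fun _ _ => rfl

/-- **A monotone program for WIN** (given the hypotheses of `outFn_iterate_eq_winFn`). -/
theorem cktSize_winFn (hp : ∀ u, p u + 2 ≤ 2 * H) {kk : ℕ}
    (hU : ∀ l ∈ (OrderedTree.univ kk H).nodes, l.length = H → l ∈ U)
    (hV : Fintype.card V ≤ 2 ^ kk - 1) (v : V) :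
    CktSize monotoneBasis01 (fun x (_ : Unit) => ParityGame.winFn o p v x)
      (2 + Fintype.card V * Fintype.card (Val U) *
          (Fintype.card (V × Val U) * (Fintype.card V + Fintype.card V)) +
        (2 * (Fintype.card V * Fintype.card V + Fintype.card V) + 2)) :=
  (cktSize_pipeline o p H v _).congr fun x _ => outFn_iterate_eq_winFn o p H hp hU hV v x

omit [Fintype V] [Nonempty V] in
/-- From a program over `{∧₂, ∨₂, 0, 1}` to the monotone circuit complexity over `{∧₂, ∨₂}`:
eliminate the constants; if the function turns out constant it has no monotone circuit at all
and its complexity is the junk value `0`. -/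
theorem circuitSizeOver_le_of_cktSize01 {ι : Type*} {g : (ι → Bool) → Bool} {s : ℕ}
    (h : CktSize monotoneBasis01 (fun x (_ : Unit) => g x) s) :
    circuitSizeOver monotoneBasis g ≤ s := by
  obtain ⟨gs, out, hl, hR⟩ := h
  rcases GateList.const_or_exists_monotone_circuit gs (out ()) hR.wf hR.isOver (hR.outOK ()) with
    ⟨b, hb⟩ | ⟨C, hCB, hCs, hCe⟩
  · have hconst : ∀ x, g x = b := fun x => (hR.eval x ()).symm.trans (hb x)
    have hempty : {s | ∃ C : Circuit ι, C.IsOver monotoneBasis ∧ C.Computes g ∧ C.size = s} = ∅ := by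
      ext s
      simp only [Set.mem_setOf_eq, Set.mem_empty_iff_false, iff_false]
      rintro ⟨C, hCB, hCg, -⟩
      have h0 := hCg fun _ => !b
      rw [Circuit.eval_const_of_isOver_monotoneBasis C hCB, hconst] at h0
      cases b <;> simp at h0
    unfold circuitSizeOver
    rw [hempty, Nat.sInf_empty]
    exact Nat.zero_le _
  · exact (circuitSizeOver_le_of_computes C hCB fun x => (hCe x).trans (hR.eval x ())).trans
      (hCs.trans hl)

end Circuit

end Summit.PneNP.PneNP.Theorems.ParityLifting
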